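import Summits.BirchSwinnertonDyer.BirchSwinnertonDyer.Theorems.SignedBaseChangeAnticyclotomicEisensteinDivisibilityTransferTorsionFree
import Literature.NumberTheory.EllipticCurves.AnticyclotomicSignedSelmerRelaxedEqualityReduction
import HarnessLib

/-!
# Castella–Wan's sentence "`Sel_±(K, 𝐓^ac) = Sel^{±,rel}(K, 𝐓^ac)`" (conjunct 5 of `stub_namedFactsSS`) modulo
# {rank one of `Sel^{±,rel}`, saturation} ONLY — the torsion-freeness input is now a theorem
# (crux `AnticyclotomicEisensteinDivisibility`, stmt-BirchSwinnertonDyer-20727, line `bdpline`; helper)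

Lead prover seat `bsd-line-sbc-p1` (gen 9), `--supports` stmt-BirchSwinnertonDyer-20727. Conjunct 5 of the
registered stub `stub_namedFactsSS` (skeleton `Lines/bdpline.lean` v33) is the refereed named fact
`AcSigned.castellaWan2024_proofThm68_selmerRel_le_selmerSgn` (Castella–Wan 2024, proof of Thm. 6.8, MS p. 30:
"both `Sel_±(K, 𝐓^ac)` and `Sel^{±,rel}(K, 𝐓^ac)` have `Λ^ac`-rank one, and hence `Sel_± = Sel^{±,rel}`, since
the quotient injects into `H¹(K_𝔭̄, 𝐓^ac)/H¹_±`, which has trivial `Λ^ac`-torsion by Proposition 3.8"). The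
INPUTS seat `bsd-input-cw24-lem67-thm68` (row G67) reduced it to its two printed inputs
(`castellaWan2024_proofThm68_selmerRel_le_selmerSgn_of_rankOne_of_saturated`, file
`Literature/…/AnticyclotomicSignedSelmerRelaxedEqualityReduction.lean`): `hA` = "`Sel^{ε, rel at 𝔭'}(K, 𝐓^ac)`
is `Λ^ac`-TORSION-FREE ∧ of `finrank` one" and `hC` = "`Sel_ε` is `Λ`-saturated in `Sel^{ε,rel}`". The
torsion-freeness half of `hA` ([PR00, §1.3.3]) is, since this seat's
`SignedBaseChangeAcDivTransferTorsionFree.transferInputs_torsionFree_of_setting` (from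
`AcSigned.selmerLambdaAdic.forall_smul_eq_zero_imp`), a KERNEL THEOREM in the `AcSigned.Setting` for every
family of local conditions — so the fact is now closed MODULO exactly {`hA'` = rank one of `Sel^{ε,rel at 𝔭'}`,
`hC` = saturation}: `selmerRel_le_selmerSgn_of_rankOne_of_saturated` below. HONEST FRAMING: the two remaining
inputs are print's global-duality rank count ((6.12) + Lemma 6.7 + Cor. 6.4) and Prop. 3.8's local
torsion-freeness of `H¹(K_𝔭̄, 𝐓^ac)/H¹_±`; neither is proved here; the named fact's text is unchanged; nothing of
the crux's research stubs is proved; BSD is not proved by any of this; no summit statement is proved by this seat.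

References: [CastellaWan2023] F. Castella, X. Wan, Math. Ann. 389 (2024), proof of Thm. 6.8 (MS p. 30),
Prop. 3.8 (MS p. 15); [PerrinRiou1995Asterisque] §1.3.3.
-/

set_option autoImplicit false
-- `…BirchSwinnertonDyer.BirchSwinnertonDyer.Theorems…` is the problem's mandated namespace (D-0017).
set_option linter.dupNamespace false

noncomputable section

open scoped Classical

namespace Summit.BirchSwinnertonDyer.BirchSwinnertonDyer.Theorems.SignedBaseChangeAcDivTransferTorsionFree

open NumberField IsDedekindDomain Field WeierstrassCurve
open Literature.NumberTheory.EllipticCurves Literature.NumberTheory.EllipticCurves.AcSigned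
  Literature.NumberTheory.EllipticCurves.ModularForms

variable {N : ℕ} [NeZero N] {W : WeierstrassCurve ℚ} [W.IsGloballyMinimal] {K : Type} [Field K]
  [NumberField K] {p : ℕ} [Fact p.Prime] {κ : ZpExtension K p} {𝔭 𝔭' : HeightOneSpectrum (𝓞 K)}

/-- **`castellaWan2024_proofThm68_selmerRel_le_selmerSgn` modulo {rank one of `Sel^{ε,rel}`, saturation}.**
The INPUTS reduction `castellaWan2024_proofThm68_selmerRel_le_selmerSgn_of_rankOne_of_saturated` asks, under the
fact's own binders, for `hA` = (`Sel^{ε, rel at 𝔭'}(K, 𝐓^ac)` torsion-free ∧ `finrank_Λ = 1`) and `hC` =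
(`Sel_ε` `Λ`-saturated in `Sel^{ε,rel at 𝔭'}`). In the `AcSigned.Setting` the torsion-freeness conjunct holds
for EVERY family of local conditions (`transferInputs_torsionFree_of_setting`: `E(K)[p] = 0` at the split
supersingular `p`, then [PR00, §1.3.3] levelwise), so only the RANK clause `hA'` — print's "both `Sel_±(K, 𝐓^ac)`
and `Sel^{±,rel}(K, 𝐓^ac)` have `Λ^ac`-rank one" for `Sel^{±,rel}` (from (6.12), Lemma 6.7, Cor. 6.4,
Prop. 3.8) — and the saturation `hC` (Prop. 3.8: "`H¹(K_𝔭̄, 𝐓^ac)/H¹_±` has trivial `Λ^ac`-torsion") remain as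
hypotheses. [cite: CastellaWan2023, proof of Thm. 6.8 (MS p. 30), Prop. 3.8 (MS p. 15)]
[cite: PerrinRiou1995Asterisque, §1.3.3] -/
theorem selmerRel_le_selmerSgn_of_rankOne_of_saturated
    (hA' : ∀ (_ : Setting W K p κ 𝔭 𝔭') (ι : PadicAlgCl p ≃+* ℂ) {f : CuspForm (CongruenceSubgroup.Gamma0 N) 2}
      (_ : IsNewformOf W f), (W.conductorNorm ℤ : ℕ) = N → SatisfiesHeegnerHypothesis N K → 3 < p →
      (∀ (w : InfinitePlace K) (k : 𝓞 K), k ∈ 𝔭.asIdeal ↔ ‖ι.symm (w.embedding (k : K))‖ < 1) →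
      ∀ (γ : absoluteGaloisGroup K) (hγ : κ.IsTopGenerator γ) (ε : ℤˣ),
        (letI := selmerLambdaAdic.moduleOfGen (W.baseChange K) p κ γ hγ (fun _ ↦ PCond.sgn ε)
         Module.finrank (IwasawaAlgebra p) (selmerLambdaAdic (W.baseChange K) p κ γ (fun _ ↦ .sgn ε)) = 1) →
        X.HasRank (W.baseChange K) p κ ∅ (fun _ ↦ .sgn ε) hγ 1 →
        (letI := selmerLambdaAdic.moduleOfGen (W.baseChange K) p κ γ hγ (PCond.at 𝔭' .rel (.sgn ε))
         Module.finrank (IwasawaAlgebra p)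
           (selmerLambdaAdic (W.baseChange K) p κ γ (PCond.at 𝔭' .rel (.sgn ε))) = 1))
    (hC : ∀ (_ : Setting W K p κ 𝔭 𝔭') (ι : PadicAlgCl p ≃+* ℂ) {f : CuspForm (CongruenceSubgroup.Gamma0 N) 2}
      (_ : IsNewformOf W f), (W.conductorNorm ℤ : ℕ) = N → SatisfiesHeegnerHypothesis N K → 3 < p →
      (∀ (w : InfinitePlace K) (k : 𝓞 K), k ∈ 𝔭.asIdeal ↔ ‖ι.symm (w.embedding (k : K))‖ < 1) →
      ∀ (γ : absoluteGaloisGroup K) (hγ : κ.IsTopGenerator γ) (ε : ℤˣ),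
        (letI := selmerLambdaAdic.moduleOfGen (W.baseChange K) p κ γ hγ (fun _ ↦ PCond.sgn ε)
         Module.finrank (IwasawaAlgebra p) (selmerLambdaAdic (W.baseChange K) p κ γ (fun _ ↦ .sgn ε)) = 1) →
        X.HasRank (W.baseChange K) p κ ∅ (fun _ ↦ .sgn ε) hγ 1 →
        ∀ (g : IwasawaAlgebra p), g ≠ 0 →
          ∀ x : selmerLambdaAdic (W.baseChange K) p κ γ (PCond.at 𝔭' .rel (.sgn ε)),
            (letI := selmerLambdaAdic.moduleOfGen (W.baseChange K) p κ γ hγ (PCond.at 𝔭' .rel (.sgn ε))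
             (g • x).1) ∈ selmerLambdaAdic (W.baseChange K) p κ γ (fun _ ↦ .sgn ε) →
            x.1 ∈ selmerLambdaAdic (W.baseChange K) p κ γ (fun _ ↦ .sgn ε)) :
    castellaWan2024_proofThm68_selmerRel_le_selmerSgn N W K p κ 𝔭 𝔭' :=
  castellaWan2024_proofThm68_selmerRel_le_selmerSgn_of_rankOne_of_saturated
    (fun hS ι _ hf hN hH hp hι γ hγ ε hrk hX ↦
      ⟨transferInputs_torsionFree_of_setting W K p κ 𝔭 𝔭' hS γ hγ (PCond.at 𝔭' .rel (.sgn ε)),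
        hA' hS ι hf hN hH hp hι γ hγ ε hrk hX⟩)
    hC

end Summit.BirchSwinnertonDyer.BirchSwinnertonDyer.Theorems.SignedBaseChangeAcDivTransferTorsionFree

end
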